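import Summits.ResolutionOfSingularities.ResolutionOfSingularities.Theorems.RisoStrataDefs
import Summits.ResolutionOfSingularities.ResolutionOfSingularities.Theorems.RisoStrataRisoGlobalisationSheafCondition
import Summits.ResolutionOfSingularities.ResolutionOfSingularities.Theorems.RisoStrataRisoGlobalisationUniformGeneration
import Summits.ResolutionOfSingularities.ResolutionOfSingularities.Theorems.RisoStrataRisoGlobalisationStepEqChart
import Literature.AlgebraicGeometry.Resolution.CanonicalResolutionProofs
import Literature.AlgebraicGeometry.Motives.SegreEmbedding

/-!
# Route RisoStrata — crux `RisoGlobalisation` (stmt-ResolutionOfSingularities-18547): the tower inside `K`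

Line SketchIdeator1 (segre re-presentation), glue part 1 of 3.  The induction on the schedule,
entirely inside the function field `K`: at each step the centre ideals
`Cen(k[hᵢ/h_β], d)` of the standard charts of the current vector `h` are nonzero
(`risoCen_ne_bot`: openness of the regular locus) and satisfy the sheaf condition
(`risoCen_sheaf`, from the leaf `stub_sheafCondition`, the only consumer of the Zariski-locality
hypothesis), hence are uniformly generated by forms `G` (leaf `stub_uniformGeneration`); the
crux's chart `step B d (G_μ/h_β^E)` is the standard chart `(β, μ)` of the Segre-type vector
`h' = (hᵢ·G_l)` (leaf `stub_stepEqChart`), so the valuative towers of `h` along `d :: rest` are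
the valuative towers of `h'` along `rest` (`risoGlob_towerInduction`).
-/

-- single-problem summit: the doubled namespace component `ResolutionOfSingularities` is forced
set_option linter.dupNamespace false

namespace Summit.ResolutionOfSingularities.ResolutionOfSingularities.Theorems

open AlgebraicGeometry CategoryTheory
open Literature.AlgebraicGeometry.Resolution Literature.AlgebraicGeometry.Motives

/-! ## Glue (algebra): the tower inside `K` -/

section Tower

variable {k K : Type} [Field k] [Field K] [Algebra k K]

/-- Elements of `Algebra.adjoin k S` lie in every subring of `K` containing `k` and `S`
(used for valuation rings `O ⊇ k`). -/
theorem risoGlob_adjoin_le_of_subset {S : Set K} {O : ValuationSubring K}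
    (hkO : ∀ c : k, algebraMap k K c ∈ O) (hS : S ⊆ O) {z : K} (hz : z ∈ Algebra.adjoin k S) :
    z ∈ O := by
  induction hz using Algebra.adjoin_induction with
  | mem x hx => exact hS hx
  | algebraMap c => exact hkO c
  | add x y _ _ hx hy => exact add_mem hx hy
  | mul x y _ _ hx hy => exact mul_mem hx hy

/-- The schedule shift: the `(t+1)`-st stage along `d :: rest` is the `t`-th stage along `rest`
started from the first chart `step B₀ d (x 0)` with the shifted denominators. -/
theorem risoStage_cons_succ (P : ∀ B : Subalgebra k K, Ideal ↥B → ℕ → Prop)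
    (B₀ : Subalgebra k K) (d : ℕ) (rest : List ℕ) (x : ℕ → K) (t : ℕ) :
    risoStage P B₀ (d :: rest) x (t + 1) =
      risoStage P (risoStep P B₀ d (x 0)) rest (fun i => x (i + 1)) t := by
  unfold risoStage
  rw [List.take_succ_cons, List.zipIdx_cons, List.foldl_cons, List.zipIdx_succ, List.foldl_map]

/-- A field is a regular local ring; hence so is the localisation of a domain at `(0)`. -/
theorem risoGlob_isRegularLocalRing_localization_bot (A : Type) [CommRing A] [IsDomain A] :
    IsRegularLocalRing (Localization.AtPrime (⊥ : Ideal A)) := by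
  have hM : (⊥ : Ideal A).primeCompl = nonZeroDivisors A := by
    ext x
    simp [Ideal.primeCompl, mem_nonZeroDivisors_iff_ne_zero]
  haveI : IsFractionRing A (Localization.AtPrime (⊥ : Ideal A)) := by
    change IsLocalization (nonZeroDivisors A) _
    rw [← hM]
    infer_instance
  letI : Field (Localization.AtPrime (⊥ : Ideal A)) := IsFractionRing.toField A
  infer_instance

/-- **The centre ideal is nonzero**: for a finitely generated `k`-subalgebra `B ⊆ K` the
singular locus of `Spec B` is a proper closed subset `V(J)`, `J ≠ 0` (openness of the regular
locus of a finitely generated algebra over a field, tree `isOpen_regularLocus_of_finiteType_field`,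
and regularity at the generic point), and `J ⊆ m` for every singular maximal ideal `m`, so
`J ≤ Cen B d`. -/
theorem risoCen_ne_bot (P : ∀ B : Subalgebra k K, Ideal ↥B → ℕ → Prop) (B : Subalgebra k K)
    (hB : B.FG) (d : ℕ) : risoCen P B d ≠ ⊥ := by
  haveI : Algebra.FiniteType k ↥B := B.fg_iff_finiteType.mp hB
  have hopen : IsOpen (regularLocus ↥B) := isOpen_regularLocus_of_finiteType_field k ↥B
  -- the singular locus is closed, `= V(J)`
  set Sing : Set (PrimeSpectrum ↥B) := (regularLocus ↥B)ᶜ with hSing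
  have hclosed : IsClosed Sing := hopen.isClosed_compl
  set J : Ideal ↥B := PrimeSpectrum.vanishingIdeal Sing with hJ
  have hVJ : PrimeSpectrum.zeroLocus (J : Set ↥B) = Sing := by
    rw [hJ, PrimeSpectrum.zeroLocus_vanishingIdeal_eq_closure, hclosed.closure_eq]
  -- the generic point is regular, so `J ≠ ⊥`
  have hgen : (⟨⊥, Ideal.isPrime_bot⟩ : PrimeSpectrum ↥B) ∈ regularLocus ↥B :=
    risoGlob_isRegularLocalRing_localization_bot ↥B
  have hJ0 : J ≠ ⊥ := by
    intro h0
    have hmem : (⟨⊥, Ideal.isPrime_bot⟩ : PrimeSpectrum ↥B) ∈ PrimeSpectrum.zeroLocus (J : Set ↥B) := by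
      rw [h0]; intro x hx; simpa using hx
    rw [hVJ] at hmem
    exact hmem hgen
  -- `J ≤ Cen`
  intro hbot
  apply hJ0
  refine le_bot_iff.mp (le_trans ?_ hbot.le)
  refine le_iInf₂ fun m hm => ?_
  obtain ⟨hmax, hnreg, -⟩ := hm
  have hp : (⟨m, hmax.isPrime⟩ : PrimeSpectrum ↥B) ∈ Sing := fun hreg => hnreg hreg
  rw [← hVJ] at hp
  exact fun x hx => hp hx

/-- Notation-free name for the standard chart ring `k[hᵢ/h_β] ⊆ K` of a vector `h`. -/
theorem risoGlob_mem_chart_of_eq {N : ℕ} (h : Fin (N + 1) → K) (β : Fin (N + 1)) {z : K} (i : Fin (N + 1))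
    (hz : z = h i * (h β)⁻¹) : z ∈ Algebra.adjoin k (Set.range fun i => h i * (h β)⁻¹) :=
  hz ▸ Algebra.subset_adjoin ⟨i, rfl⟩

/-- The common localisation of two standard charts: `k[hᵢ/h_β][(h_β'/h_β)⁻¹] = k[hᵢ/h_β'][(h_β/h_β')⁻¹]`,
both equal to `k[hᵢ/h_β, hᵢ/h_β']`. -/
theorem risoGlob_adjoin_chart_inv_eq {N : ℕ} (h : Fin (N + 1) → K) (hh : ∀ i, h i ≠ 0)
    (β β' : Fin (N + 1)) :
    Algebra.adjoin k ((Algebra.adjoin k (Set.range fun i => h i * (h β)⁻¹) : Set K) ∪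
        {(h β' * (h β)⁻¹)⁻¹}) =
      Algebra.adjoin k (Set.range (fun i => h i * (h β)⁻¹) ∪ Set.range fun i => h i * (h β')⁻¹) := by
  apply le_antisymm
  · refine Algebra.adjoin_le (Set.union_subset ?_ ?_)
    · exact Algebra.adjoin_le (Set.subset_union_left.trans Algebra.subset_adjoin)
    · rintro _ rfl
      rw [mul_inv, inv_inv, mul_comm]
      exact Algebra.subset_adjoin (Or.inr ⟨β, rfl⟩)
  · refine Algebra.adjoin_le (Set.union_subset ?_ ?_)
    · rintro _ ⟨i, rfl⟩
      exact Algebra.subset_adjoin (Or.inl (Algebra.subset_adjoin ⟨i, rfl⟩))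
    · rintro _ ⟨i, rfl⟩
      have e : h i * (h β')⁻¹ = (h i * (h β)⁻¹) * (h β' * (h β)⁻¹)⁻¹ := by
        field_simp [hh β, hh β']
      change h i * (h β')⁻¹ ∈ _
      rw [e]
      exact mul_mem (Algebra.subset_adjoin (Or.inl (Algebra.subset_adjoin ⟨i, rfl⟩)))
        (Algebra.subset_adjoin (Or.inr rfl))

/-- **The sheaf condition for the centre ideals of the standard charts of a vector** (from
`stub_sheafCondition`, i.e. from H₁): an element of `Cen(k[hᵢ/h_β], d)` becomes, after
multiplication by a power of `h_β/h_β'`, an element of `Cen(k[hᵢ/h_β'], d)`. -/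
theorem risoCen_sheaf (P : ∀ B : Subalgebra k K, Ideal ↥B → ℕ → Prop) (hloc : RisoLocal P)
    {N : ℕ} (h : Fin (N + 1) → K) (hh : ∀ i, h i ≠ 0) (d : ℕ) (β β' : Fin (N + 1))
    (c : ↥(Algebra.adjoin k (Set.range fun i => h i * (h β)⁻¹)))
    (hc : c ∈ risoCen P (Algebra.adjoin k (Set.range fun i => h i * (h β)⁻¹)) d) :
    ∃ (n : ℕ) (a : ↥(Algebra.adjoin k (Set.range fun i => h i * (h β')⁻¹))),
      a ∈ risoCen P (Algebra.adjoin k (Set.range fun i => h i * (h β')⁻¹)) d ∧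
        (a : K) = (c : K) * (h β * (h β')⁻¹) ^ n := by
  have hfg : ∀ γ : Fin (N + 1), (Algebra.adjoin k (Set.range fun i => h i * (h γ)⁻¹)).FG :=
    fun γ => Subalgebra.fg_def.mpr ⟨_, Set.finite_range _, rfl⟩
  set s : K := h β' * (h β)⁻¹ with hs
  have hs0 : s ≠ 0 := mul_ne_zero (hh β') (inv_ne_zero (hh β))
  have hsinv : s⁻¹ = h β * (h β')⁻¹ := by rw [hs, mul_inv, inv_inv, mul_comm]
  have hsB : s ∈ Algebra.adjoin k (Set.range fun i => h i * (h β)⁻¹) :=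
    Algebra.subset_adjoin ⟨β', rfl⟩
  have hsB' : s⁻¹ ∈ Algebra.adjoin k (Set.range fun i => h i * (h β')⁻¹) := by
    rw [hsinv]; exact Algebra.subset_adjoin ⟨β, rfl⟩
  have hBB' : Algebra.adjoin k ((Algebra.adjoin k (Set.range fun i => h i * (h β)⁻¹) : Set K) ∪
        {s⁻¹}) =
      Algebra.adjoin k ((Algebra.adjoin k (Set.range fun i => h i * (h β')⁻¹) : Set K) ∪
        {s⁻¹⁻¹}) := by
    rw [hs, risoGlob_adjoin_chart_inv_eq h hh β β', show (h β' * (h β)⁻¹)⁻¹⁻¹ = (h β * (h β')⁻¹)⁻¹ by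
      rw [inv_inv, mul_inv, inv_inv, mul_comm], risoGlob_adjoin_chart_inv_eq h hh β' β, Set.union_comm]
  obtain ⟨n, a, ha, hak⟩ := stub_sheafCondition (fun B m => P B m d)
    (fun B s hs hs0 hBfg m' hm' => hloc B s hs hs0 hBfg m' hm' d) _ _ (hfg β) (hfg β') s hsB hsB'
    hs0 hBB' c hc
  exact ⟨n, a, ha, by rw [hak, hsinv]⟩

/-- One Segre step of the re-presentation: the chart ring of the product vector
`h' = (hᵢ·G_l)_{(i,l)}` (flattened by `segreIndexEquiv`) at the index `(β, μ)` is the chart of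
`stub_stepEqChart`. -/
theorem risoGlob_adjoin_segre_chart_eq {N M : ℕ} (h : Fin (N + 1) → K) (G : Fin (M + 1) → K)
    (β : Fin (N + 1)) (μ : Fin (M + 1)) :
    Algebra.adjoin k (Set.range fun t : Fin (N * M + N + M + 1) =>
        (h ((segreIndexEquiv N M).symm t).1 * G ((segreIndexEquiv N M).symm t).2) *
          (h ((segreIndexEquiv N M).symm (segreIndexEquiv N M (β, μ))).1 *
            G ((segreIndexEquiv N M).symm (segreIndexEquiv N M (β, μ))).2)⁻¹) =
      Algebra.adjoin k (Set.range fun il : Fin (N + 1) × Fin (M + 1) =>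
        (h il.1 * G il.2) * (h β * G μ)⁻¹) := by
  congr 1
  simp only [Equiv.symm_apply_apply]
  ext z
  constructor
  · rintro ⟨t, rfl⟩
    exact ⟨(segreIndexEquiv N M).symm t, rfl⟩
  · rintro ⟨il, rfl⟩
    exact ⟨segreIndexEquiv N M il, by simp only [Equiv.symm_apply_apply]⟩

/-- **The induction on the schedule inside `K`** (the heart of the re-presentation line).
If a vector `h ∈ (K×)ᴺ⁺¹` admits a schedule `sched` along which every valuation ring `O ⊇ k`
containing a chart `k[hᵢ/h_β]` ends — for every admissible choice of denominators — with a
regular local ring at its centre, then there is a vector `u ∈ (K×)ᴺ'⁺¹` (the Segre iterate of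
`h` along uniformly generating forms of the successive centres) whose every chart contains a
chart of `h` and such that EVERY chart `k[u_α/u_γ] ⊆ O` of EVERY valuation ring `O ⊇ k` has a
regular local ring at the centre of `O`. Uses H₁ through `risoCen_sheaf`, and the leaves
`stub_uniformGeneration`, `stub_stepEqChart`. -/
theorem risoGlob_towerInduction (P : ∀ B : Subalgebra k K, Ideal ↥B → ℕ → Prop) (hloc : RisoLocal P)
    (sched : List ℕ) :
    ∀ (N : ℕ) (h : Fin (N + 1) → K), (∀ i, h i ≠ 0) →
      (∀ O : ValuationSubring K, (∀ c : k, algebraMap k K c ∈ O) → ∀ β : Fin (N + 1),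
        (∀ i, h i * (h β)⁻¹ ∈ O) → ∀ x : ℕ → K,
          (∀ t, t < sched.length →
            risoValid P O (risoStage P (Algebra.adjoin k (Set.range fun i => h i * (h β)⁻¹))
              sched x t) (sched.getD t 0) (x t)) →
          IsRegularLocalRing ↥(risoLoc O (risoStage P
            (Algebra.adjoin k (Set.range fun i => h i * (h β)⁻¹)) sched x sched.length))) →
      ∃ (N' : ℕ) (u : Fin (N' + 1) → K), (∀ γ, u γ ≠ 0) ∧
        (∀ γ, ∃ β, Algebra.adjoin k (Set.range fun i => h i * (h β)⁻¹) ≤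
          Algebra.adjoin k (Set.range fun α => u α * (u γ)⁻¹)) ∧
        ∀ O : ValuationSubring K, (∀ c : k, algebraMap k K c ∈ O) → ∀ γ : Fin (N' + 1),
          (∀ α, u α * (u γ)⁻¹ ∈ O) →
            IsRegularLocalRing ↥(risoLoc O (Algebra.adjoin k (Set.range fun α => u α * (u γ)⁻¹))) := by
  induction sched with
  | nil =>
    intro N h hh hyp
    refine ⟨N, h, hh, fun γ => ⟨γ, le_refl _⟩, fun O hkO γ hγ => ?_⟩
    have hreg := hyp O hkO γ hγ (fun _ => 0) (fun t ht => absurd ht (Nat.not_lt_zero t))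
    have e0 : risoStage P (Algebra.adjoin k (Set.range fun i => h i * (h γ)⁻¹)) [] (fun _ => 0)
        ([] : List ℕ).length = Algebra.adjoin k (Set.range fun i => h i * (h γ)⁻¹) := by
      simp [risoStage]
    rw [e0] at hreg
    exact hreg
  | cons d rest ih =>
    intro N h hh hyp
    -- the centre ideals of the charts of `h` at level `d`, uniformly generated by forms `G`
    obtain ⟨E, M, G, hG, hG0, hspan⟩ := stub_uniformGeneration h hh
      (fun β => risoCen P (Algebra.adjoin k (Set.range fun i => h i * (h β)⁻¹)) d)
      (fun β => risoCen_ne_bot P _ (Subalgebra.fg_def.mpr ⟨_, Set.finite_range _, rfl⟩) d)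
      (fun β β' c hc => risoCen_sheaf P hloc h hh d β β' c hc)
    -- the Segre vector `h' = (hᵢ G_l)`
    set e := segreIndexEquiv N M with he
    set h' : Fin (N * M + N + M + 1) → K := fun t => h (e.symm t).1 * G (e.symm t).2 with hh'def
    have hh' : ∀ t, h' t ≠ 0 := fun t => mul_ne_zero (hh _) (hG0 _)
    have h'e : ∀ il, h' (e il) = h il.1 * G il.2 := fun il => by
      simp only [hh'def, Equiv.symm_apply_apply]
    -- `step = chart`
    have hstep : ∀ (β : Fin (N + 1)) (μ : Fin (M + 1)),
        risoStep P (Algebra.adjoin k (Set.range fun i => h i * (h β)⁻¹)) d (G μ * (h β ^ E)⁻¹) =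
          Algebra.adjoin k (Set.range fun α => h' α * (h' (e (β, μ)))⁻¹) := by
      intro β μ
      rw [risoStep, ← hspan β, stub_stepEqChart h hh β G E μ (hG0 μ) (hG β),
        ← risoGlob_adjoin_segre_chart_eq h G β μ]
    -- charts of `h` inside charts of `h'`
    have hchart : ∀ (β : Fin (N + 1)) (μ : Fin (M + 1)),
        Algebra.adjoin k (Set.range fun i => h i * (h β)⁻¹) ≤
          Algebra.adjoin k (Set.range fun α => h' α * (h' (e (β, μ)))⁻¹) := by
      intro β μ
      refine Algebra.adjoin_le ?_
      rintro _ ⟨i, rfl⟩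
      refine risoGlob_mem_chart_of_eq h' (e (β, μ)) (e (i, μ)) ?_
      rw [h'e, h'e]
      field_simp [hG0 μ, hh β]
    -- the hypothesis of the induction for `h'` and `rest`
    have hyp' : ∀ O : ValuationSubring K, (∀ c : k, algebraMap k K c ∈ O) →
        ∀ γ' : Fin (N * M + N + M + 1), (∀ α, h' α * (h' γ')⁻¹ ∈ O) → ∀ x' : ℕ → K,
          (∀ t, t < rest.length →
            risoValid P O (risoStage P (Algebra.adjoin k (Set.range fun α => h' α * (h' γ')⁻¹))
              rest x' t) (rest.getD t 0) (x' t)) →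
          IsRegularLocalRing ↥(risoLoc O (risoStage P
            (Algebra.adjoin k (Set.range fun α => h' α * (h' γ')⁻¹)) rest x' rest.length)) := by
      intro O hkO γ' hγ' x' hval'
      obtain ⟨⟨β, μ⟩, rfl⟩ : ∃ il, e il = γ' := ⟨e.symm γ', e.apply_symm_apply γ'⟩
      -- `k[hᵢ/h_β] ⊆ O`
      have hβ : ∀ i, h i * (h β)⁻¹ ∈ O := fun i =>
        risoGlob_adjoin_le_of_subset hkO (by rintro _ ⟨α, rfl⟩; exact hγ' α) (hchart β μ
          (Algebra.subset_adjoin ⟨i, rfl⟩))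
      -- the chart `k[h'/h'_(β,μ)] ⊆ O`
      have hC' : ∀ z ∈ Algebra.adjoin k (Set.range fun α => h' α * (h' (e (β, μ)))⁻¹), z ∈ O :=
        fun z hz => risoGlob_adjoin_le_of_subset hkO (by rintro _ ⟨α, rfl⟩; exact hγ' α) hz
      -- denominators: the new one first
      set x₀ : K := G μ * (h β ^ E)⁻¹ with hx₀
      let x : ℕ → K := fun t => Nat.casesOn t x₀ x'
      have hx0 : x 0 = x₀ := rfl
      have hxs : (fun i => x (i + 1)) = x' := rfl
      have hval : ∀ t, t < (d :: rest).length →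
          risoValid P O (risoStage P (Algebra.adjoin k (Set.range fun i => h i * (h β)⁻¹))
            (d :: rest) x t) ((d :: rest).getD t 0) (x t) := by
        intro t ht
        cases t with
        | zero =>
          simp only [risoStage_zero, List.getD_cons_zero, hx0]
          refine ⟨mul_ne_zero (hG0 μ) (inv_ne_zero (pow_ne_zero _ (hh β))),
            ⟨⟨x₀, hG β μ⟩, ?_, rfl⟩, fun a' ha' => ?_⟩
          · rw [← hspan β]
            exact Ideal.subset_span ⟨μ, rfl⟩
          · apply hC'
            rw [← hstep β μ]
            exact Algebra.subset_adjoin (Or.inr ⟨a', ha', rfl⟩)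
        | succ t =>
          rw [risoStage_cons_succ, hx0, hstep β μ, hxs, List.getD_cons_succ]
          exact hval' t (by simpa using ht)
      have hreg := hyp O hkO β hβ x hval
      rwa [List.length_cons, risoStage_cons_succ, hx0, hstep β μ, hxs] at hreg
    obtain ⟨N', u, hu, hcharts, hreg⟩ := ih _ h' hh' hyp'
    refine ⟨N', u, hu, fun γ => ?_, hreg⟩
    obtain ⟨γ', hγ'⟩ := hcharts γ
    obtain ⟨⟨β, μ⟩, rfl⟩ : ∃ il, e il = γ' := ⟨e.symm γ', e.apply_symm_apply γ'⟩
    exact ⟨β, (hchart β μ).trans hγ'⟩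

end Tower

end Summit.ResolutionOfSingularities.ResolutionOfSingularities.Theorems
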